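import Summits.NavierStokesRegularity.FunctionalMining.SaturatingLawSupMixture
import HarnessLib

/-!
# FunctionalMining — K1-Q6 typed: the door D-K6 escapes as candidate saturating laws (dict seat gen 34)

HONEST FRAMING. Search for candidate a priori estimates; no regularity claim. Nothing about
Navier–Stokes is asserted here: the candidate laws are `@[conjecture] def`s (NAMED `Prop`s, open), and
the theorems are bookkeeping about the one-sided-derivative-value law `SaturatingLawSup`
(`SaturatingLawSup.lean`): perturbation by a functional that obeys the law in the `IsRateBudget` form,
and passage to the limit in a vanishing perturbation.

FILING. Staged as `pub-nsfunc-dict/SpectralMixtureCandidates.lean` (sha256 b69cec1c038e0a61, 408 lines)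
and filed by the prove seat (gen 24) in TWO parts for the 400-line lint: the two `SaturatingLawSup`
bookkeeping lemmas (`DifferentiableAlongNS`, `SaturatingLawSup.add_smul`,
`SaturatingLawSup.of_add_smul_tendsto_zero`) are `SaturatingLawSupMixture.lean`; THIS file carries the
K1-Q6 typed candidates (a)/(b)/(c), declarations byte-identical to the staged file, same order (two
docstrings added for the gate's docstring lint: `topEigStrainMix_nonneg`, `topBotEigMoment_nonneg`).

CONTEXT (dictionary question K1-Q6, no-go door D-K6 of `pub-nsfunc/NOGO.md` v7.124–v7.128, §3). At the
K0 exponents `σ = 2q − 3`, `γ = (3q − 3)/(2q − 3)` the non-selective strain moment `Z_q = ∫|S|^q` obeys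
the saturating law `T_LD` for some `κ` (tree: `StrainMoment.strainMoment_saturatingLaw`, `q > 2`;
`strainMoment_two_saturatingLaw`, `q = 2`), while for the spectral cores `Φ_q = ∫(λ₁⁺)^q`,
`Ψ_q = ∫((−λ₃)⁺)^q` the no-go seat records the law FALSE for every `κ` (booking (W2); kernel door
`TopEigSaturatingKill` STAGED, not in the tree: from a family of data with a production floor, bounded
budgets and vanishing heat price to `∀ κ, ¬ SaturatingLawSup Φ_q σ γ κ`). The door lists three typed
escapes for a spectral `𝒦₁` candidate; this file types them as `Prop`s over the tree's objects:

* **(a) mixtures `F_ε = Φ_q + ε Z_q`** (`topEigStrainMix q ε`): the candidate law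
  `TopEigStrainMixLaw q ε := ∃ κ ≥ 0, SaturatingLawSup F_ε (2q−3) ((3q−3)/(2q−3)) κ` (OPEN for every
  `ε > 0`; not killed by the W18 family per the census computations DK6-HEATPRICE-A/B, three-hand) and the
  dictionary number of the escape, the RATE of the best constant as `ε ↓ 0`:
  `TopEigStrainMixRate q a := ∃ C ε₀ > 0, ∀ ε ∈ (0, ε₀], SaturatingLawSup F_ε … (C ε^{−a})`.
  PROVED (bookkeeping): the set of `ε` at which the law holds is an up-set
  (`TopEigStrainMixLaw.mono`, from `SaturatingLawSup.add_smul`), and the NECESSITY clause of the door —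
  a constant bounded as `ε ↓ 0` passes to the limit and hands `Φ_q` the law
  (`SaturatingLawSup.of_add_smul_tendsto_zero`), hence **`(∀ κ, ¬ law Φ_q κ) → TopEigStrainMixRate q a → 0 < a`**
  (`TopEigStrainMixRate.pos_of_not_saturatingLawSup`): given the kill, the exponent of escape (a) is
  positive.
* **(b) low moments** `Φ_q`, `3/2 < q < 2`: no new object — the obligation is `TopEigHeatCoercivePos q`
  (`TopEigHeatCoercive.lean`, OPEN on `0 < q < 2`); the kernel implication to the law
  (`topEigMoment_saturatingLawSup_of_heatCoercivePos`) is proved for `q ≥ 2` only. Recorded in a docstring.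
* **(c) the symmetrised core `Φ_q + Ψ_q`** (`topBotEigMoment q`): the candidate law `TopBotEigMomentLaw q`
  and its heat-coercivity `TopBotEigHeatCoercivePos q` (both OPEN; W18 kills neither sign per D-K6 (W-5));
  bookkeeping: invariance under `v ↦ −v`.

No `sInf`/`sSup` of a possibly empty set is used as a number: every dictionary quantity is a `Prop`.

[ours, bookkeeping; candidate rows open]
-/

noncomputable section

open MeasureTheory Set Filter Topology

namespace Summit.NavierStokesRegularity.FunctionalMining

open Literature.Analysis.FunctionSpaces Literature.Analysis.FluidPDE

variable {d : Type*} [Fintype d] [DecidableEq d]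

/-! ### K1-Q6 (a): the mixtures `F_ε = Φ_q + ε Z_q` -/

/-- **`F_ε = Φ_q + ε Z_q = ∫(λ₁⁺)^q(S) + ε ∫|S|^q`** — escape (a) of door D-K6 ("charge frame rotation":
the strain moment's heat price charges the full gradient `q|S|^{q−2}|∇S|²`, eigenframe rotation included).
[ours; candidate core, K1-Q6 (a)] -/
def topEigStrainMix (q ε : ℝ) (v : UnitAddTorus d → EuclideanSpace ℝ d) : ℝ :=
  torusTopEigMoment q v + ε * torusStrainMoment q v

/-- `F_ε = Φ_q + ε Z_q ≥ 0` for `ε ≥ 0`. [ours, bookkeeping] -/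
theorem topEigStrainMix_nonneg {q ε : ℝ} (hε : 0 ≤ ε) (v : UnitAddTorus d → EuclideanSpace ℝ d) :
    0 ≤ topEigStrainMix q ε v :=
  add_nonneg (torusTopEigMoment_nonneg q v) (mul_nonneg hε (torusStrainMoment_nonneg q v))

/-- **Candidate law K1-Q6 (a) at level `ε`:** `∃ κ ≥ 0, SaturatingLawSup F_ε (2q−3) ((3q−3)/(2q−3)) κ`.
OPEN for every real `q ≥ 2` and every `ε > 0` (D-K6 (a), (W-4): not killed by the W18 family nor by any
mollified piecewise-constant-strain wall — census DK6-HEATPRICE, three-hand; no rate on record).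
[ours; open question] -/
@[conjecture] def TopEigStrainMixLaw (q ε : ℝ) : Prop :=
  ∃ κ : ℝ, 0 ≤ κ ∧
    SaturatingLawSup (d := d) (topEigStrainMix q ε) (2 * q - 3) ((3 * q - 3) / (2 * q - 3)) κ

/-- **The dictionary number of escape (a): a RATE EXPONENT.** `TopEigStrainMixRate q a` says the law for
`F_ε` holds with constant `C ε^{−a}` for all small `ε`: `∃ C, ∃ ε₀ > 0, ∀ ε ∈ (0, ε₀],
SaturatingLawSup F_ε (2q−3) ((3q−3)/(2q−3)) (C ε^{−a})`. The K1-Q6 (a) entry is the infimum of such `a`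
(reported as bounds on `a`, never as an `sInf`). OPEN for every `a`. [ours; open question] -/
@[conjecture] def TopEigStrainMixRate (q a : ℝ) : Prop :=
  ∃ C ε₀ : ℝ, 0 < ε₀ ∧ ∀ ε : ℝ, 0 < ε → ε ≤ ε₀ →
    SaturatingLawSup (d := d) (topEigStrainMix q ε) (2 * q - 3) ((3 * q - 3) / (2 * q - 3)) (C * ε ^ (-a))

/-- At level `ε = 0` the mixture is `Φ_q` itself. [ours, bookkeeping] -/
theorem topEigStrainMix_zero (q : ℝ) : topEigStrainMix (d := d) q 0 = torusTopEigMoment q := by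
  funext v; simp [topEigStrainMix]

/-- **Level `0` of K1-Q6 (a) is the `λ₁` row in one-sided-derivative-value form:**
`TopEigStrainMixLaw q 0 ↔ ∃ κ, SaturatingLawSup Φ_q (2q−3) ((3q−3)/(2q−3)) κ` — so the (W2) kill
"FALSE for every κ" reads `¬ TopEigStrainMixLaw q 0`. [ours, bookkeeping] -/
theorem topEigStrainMixLaw_zero_iff (q : ℝ) :
    TopEigStrainMixLaw (d := d) q 0 ↔
      ∃ κ : ℝ, SaturatingLawSup (d := d) (torusTopEigMoment q) (2 * q - 3) ((3 * q - 3) / (2 * q - 3)) κ := by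
  simp only [TopEigStrainMixLaw, topEigStrainMix_zero]
  constructor
  · rintro ⟨κ, -, h⟩; exact ⟨κ, h⟩
  · rintro ⟨κ, h⟩
    exact ⟨max κ 0, le_max_right _ _, h.mono_kappa (torusTopEigMoment_nonneg q) (le_max_left _ _)⟩

/-- **The rate statements form an up-set in the exponent:** `TopEigStrainMixRate q a → a ≤ a' →
TopEigStrainMixRate q a'` (shrink `ε₀` below `1`, where `ε^{−a} ≤ ε^{−a'}`, and replace `C` by `|C|`). So
the K1-Q6 (a) entry "the infimum of the admissible exponents" is well posed as a Dedekind cut of `Prop`s.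
[ours, bookkeeping] -/
theorem TopEigStrainMixRate.mono {q a a' : ℝ} (h : TopEigStrainMixRate (d := d) q a) (haa' : a ≤ a') :
    TopEigStrainMixRate (d := d) q a' := by
  obtain ⟨C, ε₀, hε₀, hlaw⟩ := h
  refine ⟨|C|, min ε₀ 1, lt_min hε₀ one_pos, fun ε hε hεle => ?_⟩
  have hε₀' : ε ≤ ε₀ := hεle.trans (min_le_left _ _)
  have hε1 : ε ≤ 1 := hεle.trans (min_le_right _ _)
  refine (hlaw ε hε hε₀').mono_kappa (topEigStrainMix_nonneg hε.le) ?_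
  calc C * ε ^ (-a) ≤ |C| * ε ^ (-a) :=
        mul_le_mul_of_nonneg_right (le_abs_self C) (Real.rpow_nonneg hε.le _)
    _ ≤ |C| * ε ^ (-a') :=
        mul_le_mul_of_nonneg_left (Real.rpow_le_rpow_of_exponent_ge hε hε1 (by linarith))
          (abs_nonneg C)

/-- A rate gives the law at every small level (with the non-negative constant `|C| ε^{−a}`).
[ours, bookkeeping] -/
theorem TopEigStrainMixRate.law_of_le {q a : ℝ} (h : TopEigStrainMixRate (d := d) q a) :
    ∃ ε₀ : ℝ, 0 < ε₀ ∧ ∀ ε : ℝ, 0 < ε → ε ≤ ε₀ → TopEigStrainMixLaw (d := d) q ε := by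
  obtain ⟨C, ε₀, hε₀, hlaw⟩ := h
  refine ⟨ε₀, hε₀, fun ε hε hεle => ⟨|C| * ε ^ (-a), mul_nonneg (abs_nonneg C) (Real.rpow_nonneg hε.le _),
    (hlaw ε hε hεle).mono_kappa (topEigStrainMix_nonneg hε.le)
      (mul_le_mul_of_nonneg_right (le_abs_self C) (Real.rpow_nonneg hε.le _))⟩⟩

/-- The K0 exponent `1 + 1/σ` is non-negative for `σ = 2q − 3`, `q ≥ 2`. [ours, bookkeeping] -/
theorem one_add_inv_sigma_nonneg {q : ℝ} (hq : 2 ≤ q) : 0 ≤ 1 + (2 * q - 3)⁻¹ := by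
  have : 0 < 2 * q - 3 := by linarith
  positivity

/-- **Up-set in `ε` (generic exponents).** Given the strain-moment row in the `IsRateBudget` form with a
non-negative constant, the law for `F_ε` implies the law for `F_ε'`, `ε ≤ ε'`, with constant
`κ + (ε' − ε)^{−1/σ} κ_Z`. [ours, bookkeeping] -/
theorem SaturatingLawSup.topEigStrainMix_mono {q σ γ κ κZ ε ε' : ℝ}
    (h : SaturatingLawSup (d := d) (topEigStrainMix q ε) σ γ κ)
    (hZ : SaturatingLaw (d := d) (torusStrainMoment q) σ γ κZ) (hκ : 0 ≤ κ) (hκZ : 0 ≤ κZ)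
    (hp : 0 ≤ 1 + σ⁻¹) (hε : 0 ≤ ε) (hεε' : ε < ε') :
    SaturatingLawSup (d := d) (topEigStrainMix q ε') σ γ (κ + (ε' - ε) ^ (-σ⁻¹) * κZ) := by
  have h1 := SaturatingLawSup.add_smul h hZ (topEigStrainMix_nonneg hε) (torusStrainMoment_nonneg q)
    hκ hκZ hp (sub_pos.mpr hεε')
  have h2 : (fun v => topEigStrainMix q ε v + (ε' - ε) * torusStrainMoment q v) =
      topEigStrainMix (d := d) q ε' := by
    funext v; simp only [topEigStrainMix]; ring
  rwa [h2] at h1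

/-- **The set of `ε ≥ 0` at which K1-Q6 (a) holds is an up-set**, for every real `q ≥ 2` on `T³` (the
strain-moment row `ES.absS.q | T_LD` is a tree theorem: `strainMoment_saturatingLaw` for `q > 2`,
`strainMoment_two_saturatingLaw` at `q = 2`). [ours, bookkeeping] -/
theorem TopEigStrainMixLaw.mono {q ε ε' : ℝ} (hq : 2 ≤ q) (h : TopEigStrainMixLaw (d := Fin 3) q ε)
    (hε : 0 ≤ ε) (hεε' : ε ≤ ε') : TopEigStrainMixLaw (d := Fin 3) q ε' := by
  rcases hεε'.eq_or_lt with rfl | hlt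
  · exact h
  obtain ⟨κ, hκ, hlaw⟩ := h
  -- the strain-moment row with a non-negative constant
  obtain ⟨κZ, hκZ, hZ⟩ : ∃ κZ : ℝ, 0 ≤ κZ ∧
      SaturatingLaw (d := Fin 3) (torusStrainMoment q) (2 * q - 3) ((3 * q - 3) / (2 * q - 3)) κZ := by
    rcases hq.eq_or_lt with rfl | hq'
    · refine ⟨27 / (16 * Real.pi ^ 4), by positivity, ?_⟩
      have h2 := strainMoment_two_saturatingLaw (d := Fin 3)
      norm_num at h2 ⊢; exact h2
    · obtain ⟨κZ, hZ⟩ := StrainMoment.strainMoment_saturatingLaw hq'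
      exact ⟨max κZ 0, le_max_right _ _, hZ.mono_kappa (torusStrainMoment_nonneg q) (le_max_left _ _)⟩
  exact ⟨κ + (ε' - ε) ^ (-(2 * q - 3)⁻¹) * κZ,
    add_nonneg hκ (mul_nonneg (Real.rpow_nonneg (sub_pos.mpr hlt).le _) hκZ),
    hlaw.topEigStrainMix_mono hZ hκ hκZ (one_add_inv_sigma_nonneg hq) hε hlt⟩

/-- **A rate gives K1-Q6 (a) at EVERY level `ε > 0`** on `T³`, `q ≥ 2` (small levels from the rate,
large ones by the up-set property). [ours, bookkeeping] -/
theorem TopEigStrainMixRate.law {q a ε : ℝ} (hq : 2 ≤ q) (h : TopEigStrainMixRate (d := Fin 3) q a)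
    (hε : 0 < ε) : TopEigStrainMixLaw (d := Fin 3) q ε := by
  obtain ⟨ε₀, hε₀, hlaw⟩ := h.law_of_le
  by_cases hle : ε ≤ ε₀
  · exact hlaw ε hε hle
  · exact (hlaw ε₀ hε₀ le_rfl).mono hq hε₀.le (le_of_not_ge hle)

/-- **Necessity for K1-Q6 (a) (generic exponents):** if the laws for `F_{εₙ}` hold with one constant `κ`
along `εₙ → 0` and `Z_q` is differentiable along solutions, then `Φ_q` obeys the law with `κ`.
[ours, bookkeeping] -/
theorem SaturatingLawSup.topEigMoment_of_mix_tendsto_zero {q σ γ κ : ℝ} {ε : ℕ → ℝ}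
    (hlaw : ∀ n, SaturatingLawSup (d := d) (topEigStrainMix q (ε n)) σ γ κ)
    (hε : Tendsto ε atTop (𝓝 0)) (hZ : DifferentiableAlongNS (d := d) (torusStrainMoment q))
    (hp : 0 ≤ 1 + σ⁻¹) : SaturatingLawSup (d := d) (torusTopEigMoment q) σ γ κ :=
  SaturatingLawSup.of_add_smul_tendsto_zero (G := torusStrainMoment q) hlaw hε hZ hp

/-- `Z_q` is differentiable along solutions on `T³` for every real `q ≥ 2` (from the tree's
`ES.absS.q | T_LD` rows, which are `IsRateBudget`s). [ours, bookkeeping] -/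
theorem differentiableAlongNS_torusStrainMoment {q : ℝ} (hq : 2 ≤ q) :
    DifferentiableAlongNS (d := Fin 3) (torusStrainMoment q) := by
  rcases hq.eq_or_lt with rfl | hq'
  · exact (strainMoment_two_saturatingLaw (d := Fin 3)).differentiableAlongNS
  · obtain ⟨κZ, hZ⟩ := StrainMoment.strainMoment_saturatingLaw hq'
    exact hZ.differentiableAlongNS

/-- **A bounded constant is impossible under the kill.** If `Φ_q` obeys the law for NO `κ` (the (W2)
booking; kernel door `TopEigSaturatingKill` staged) then no single `κ` serves the mixtures `F_{εₙ}` along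
any sequence `εₙ → 0` (`q ≥ 2`, K0 exponents). [ours, bookkeeping] -/
theorem exists_not_topEigStrainMixLaw_of_not_saturatingLawSup {q : ℝ} (hq : 2 ≤ q)
    (hkill : ∀ κ : ℝ, ¬ SaturatingLawSup (d := Fin 3) (torusTopEigMoment q) (2 * q - 3)
      ((3 * q - 3) / (2 * q - 3)) κ)
    (κ : ℝ) {ε : ℕ → ℝ} (hε : Tendsto ε atTop (𝓝 0)) :
    ∃ n, ¬ SaturatingLawSup (d := Fin 3) (topEigStrainMix q (ε n)) (2 * q - 3)
      ((3 * q - 3) / (2 * q - 3)) κ := by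
  by_contra h
  push Not at h
  exact hkill κ (SaturatingLawSup.topEigMoment_of_mix_tendsto_zero h hε
    (differentiableAlongNS_torusStrainMoment hq) (one_add_inv_sigma_nonneg hq))

/-- **K1-Q6 (a), typed dictionary consequence of the kill: the rate exponent is positive.** If `Φ_q` obeys
the saturating law for no `κ` then `TopEigStrainMixRate q a → 0 < a` (`q ≥ 2`): a rate `C ε^{−a}` with
`a ≤ 0` is bounded by `|C| ε₀^{−a}` on `(0, ε₀]`, and a bounded constant passes to the limit.
[ours, bookkeeping] -/
theorem TopEigStrainMixRate.pos_of_not_saturatingLawSup {q a : ℝ} (hq : 2 ≤ q)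
    (hkill : ∀ κ : ℝ, ¬ SaturatingLawSup (d := Fin 3) (torusTopEigMoment q) (2 * q - 3)
      ((3 * q - 3) / (2 * q - 3)) κ)
    (h : TopEigStrainMixRate (d := Fin 3) q a) : 0 < a := by
  by_contra ha
  push Not at ha
  obtain ⟨C, ε₀, hε₀, hlaw⟩ := h
  -- one constant for all `ε ∈ (0, ε₀]`
  set κ := |C| * ε₀ ^ (-a) with hκ_def
  have hunif : ∀ ε : ℝ, 0 < ε → ε ≤ ε₀ →
      SaturatingLawSup (d := Fin 3) (topEigStrainMix q ε) (2 * q - 3) ((3 * q - 3) / (2 * q - 3)) κ := by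
    intro ε hε hεle
    refine (hlaw ε hε hεle).mono_kappa (topEigStrainMix_nonneg hε.le) ?_
    have h1 : ε ^ (-a) ≤ ε₀ ^ (-a) := Real.rpow_le_rpow hε.le hεle (by linarith)
    calc C * ε ^ (-a) ≤ |C| * ε ^ (-a) :=
          mul_le_mul_of_nonneg_right (le_abs_self C) (Real.rpow_nonneg hε.le _)
      _ ≤ |C| * ε₀ ^ (-a) := mul_le_mul_of_nonneg_left h1 (abs_nonneg C)
  -- the sequence `εₙ = ε₀/(n+1)`
  have hseq : Tendsto (fun n : ℕ => ε₀ / ((n : ℝ) + 1)) atTop (𝓝 0) := by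
    have h := tendsto_one_div_add_atTop_nhds_zero_nat.const_mul ε₀
    simp only [mul_zero] at h
    refine h.congr (fun n => ?_)
    ring
  obtain ⟨n, hn⟩ := exists_not_topEigStrainMixLaw_of_not_saturatingLawSup hq hkill κ hseq
  have hpos : 0 < ε₀ / ((n : ℝ) + 1) := div_pos hε₀ (by positivity)
  have hle : ε₀ / ((n : ℝ) + 1) ≤ ε₀ := div_le_self hε₀.le (by linarith [n.cast_nonneg (α := ℝ)])
  exact hn (hunif _ hpos hle)

/-! ### K1-Q6 (b): low moments — no new object

Escape (b) of door D-K6 is `Φ_q` (`Ψ_q`) with `3/2 < q < 2` (`σ = 2q − 3 > 0` keeps the template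
meaningful; no `𝒦₀` row lives there). Its first obligation is Lemma L-λ(q) = `TopEigHeatCoercivePos q`
(`TopEigHeatCoercive.lean`; OPEN on `0 < q < 2`, FAILS on paper for `q ≥ 2`, nogo THEOREM A (i)); the
kernel implication `TopEigHeatCoercivePos q → ∃ κ, SaturatingLawSup Φ_q (2q−3) ((3q−3)/(2q−3)) κ`
(`topEigMoment_saturatingLawSup_of_heatCoercivePos`) is proved for `q ≥ 2` ONLY — for `3/2 < q < 2` both
the lemma and the implication are open. Nothing is typed anew. -/

/-! ### K1-Q6 (c): the symmetrised core `Φ_q + Ψ_q` -/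

/-- **`Φ_q + Ψ_q = ∫(λ₁⁺)^q(S) + ∫((−λ₃)⁺)^q(S)`** — escape (c) of door D-K6. [ours; candidate core] -/
def topBotEigMoment (q : ℝ) (v : UnitAddTorus d → EuclideanSpace ℝ d) : ℝ :=
  torusTopEigMoment q v + torusNegBotEigMoment q v

/-- `Φ_q + Ψ_q ≥ 0`. [ours, bookkeeping] -/
theorem topBotEigMoment_nonneg (q : ℝ) (v : UnitAddTorus d → EuclideanSpace ℝ d) :
    0 ≤ topBotEigMoment q v :=
  add_nonneg (torusTopEigMoment_nonneg q v) (torusNegBotEigMoment_nonneg q v)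

/-- The symmetrised core is even under `v ↦ −v` (the `λ₁` core of `−v` is the `−λ₃` core of `v`,
`torusTopEigMoment_neg`). [ours, bookkeeping] -/
theorem topBotEigMoment_neg (q : ℝ) (v : UnitAddTorus d → EuclideanSpace ℝ d) :
    topBotEigMoment q (-v) = topBotEigMoment q v := by
  simp only [topBotEigMoment, torusTopEigMoment_neg, torusNegBotEigMoment_neg, add_comm]

/-- **Candidate law K1-Q6 (c):** `∃ κ ≥ 0, SaturatingLawSup (Φ_q + Ψ_q) (2q−3) ((3q−3)/(2q−3)) κ`. OPEN for
every real `q ≥ 2` (D-K6 (c), (W-5): W18 kills `Φ_q + Ψ_q` from neither sign; no two-well wall does, census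
THEOREM U / LEMMA C; no rate on record). [ours; open question] -/
@[conjecture] def TopBotEigMomentLaw (q : ℝ) : Prop :=
  ∃ κ : ℝ, 0 ≤ κ ∧
    SaturatingLawSup (d := d) (topBotEigMoment q) (2 * q - 3) ((3 * q - 3) / (2 * q - 3)) κ

/-- **Lemma L-λ for the symmetrised core:** `∃ c > 0, HeatCoercive (Φ_q + Ψ_q) c` — the coercive step that
the proof template of Theorem G (ii) would need for (c). OPEN. [ours; open question] -/
@[conjecture] def TopBotEigHeatCoercivePos (q : ℝ) : Prop :=
  ∃ c : ℝ, 0 < c ∧ HeatCoercive (d := d) (topBotEigMoment q) c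

/-- Larger `κ` is the weaker law (c). [ours, bookkeeping] -/
theorem TopBotEigMomentLaw.of_le {q κ κ' : ℝ}
    (h : SaturatingLawSup (d := d) (topBotEigMoment q) (2 * q - 3) ((3 * q - 3) / (2 * q - 3)) κ)
    (hκ : κ ≤ κ') (hκ0 : 0 ≤ κ') : TopBotEigMomentLaw (d := d) q :=
  ⟨κ', hκ0, h.mono_kappa (topBotEigMoment_nonneg q) hκ⟩

/-- Any constant gives a non-negative one, for law (c). [ours, bookkeeping] -/
theorem topBotEigMomentLaw_of_exists {q : ℝ}
    (h : ∃ κ : ℝ, SaturatingLawSup (d := d) (topBotEigMoment q) (2 * q - 3) ((3 * q - 3) / (2 * q - 3)) κ) :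
    TopBotEigMomentLaw (d := d) q := by
  obtain ⟨κ, hκ⟩ := h
  exact TopBotEigMomentLaw.of_le hκ (le_max_left κ 0) (le_max_right κ 0)

end Summit.NavierStokesRegularity.FunctionalMining

end
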